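import Mathlib
import HarnessLib
import Literature.Combinatorics.Additive.OptimallySmallSumsets
import Literature.Combinatorics.Additive.KneserSeveralSummands
import Literature.GroupTheory.FiniteAbelian.SubgroupsOfAllOrders

/-!
# Optimally small sumsets with several summands (Plagne 2006/2007): the function
# `μ_G^{(k)}(r₁,…,r_k) = min_{d ∣ |G|} (⌈r₁/d⌉ + ⋯ + ⌈r_k/d⌉ − k + 1)·d`

Topic `Literature/Combinatorics/Additive`.  Cell `mm-stpp` (D-0046), seat `mm-stpp-lit` (gen 10).  The `k`-summand
companion of `OptimallySmallSumsets.lean` (`k = 2`: Eliahou–Kervaire–Plagne 2003, `ekpTerm`, `ekpMu`): the size-only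
floor for a sum of `k` sets of prescribed sizes in a finite abelian group — the shape a `k`-room "Kneser budget" of
the cell's instruments would have (LIT-INDEX §8 N31/N32) — with its name, its Kneser lower bound in every finite
abelian group, and its exactness in `ℤ/n`.

**Definition / Theorem (Plagne, Funct. Approx. Comment. Math. 37 (2007) 377–397, p. 378 eq. (1) and p. 379
eq. (2); the formula is proved in Plagne, Unif. Distrib. Theory 1 (2006) 27–44, for every abelian group).**
`μ_G^{(k)}(r₁,…,r_k) := min {|A₁ + ⋯ + A_k| : A_i ⊆ G, |A_i| = r_i}` and
"`μ_G^{(k)}(r₁,…,r_k) = min_{d ∈ D} (⌈r₁/d⌉ + ⋯ + ⌈r_k/d⌉ − k + 1) d`, where `D` is the set of integers that are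
the cardinality of a finite subgroup of `G`" (for finite abelian `G`: the divisors of `|G|`).

Here (all sorry-free, no named facts):
* `ekpTermK d r = d·Σ_i ⌈r_i/d⌉ − (k − 1)·d` and `ekpMuK n r = min_{d ∣ n} ekpTermK d r` (definitions, for
  `r : Fin k → ℕ`; `ekpTermK_two : ekpTermK d ![r, s] = ekpTerm d r s`), bookkeeping `ekpMuK_le_ekpTermK`,
  `exists_dvd_ekpMuK_eq`, `le_ekpMuK`;
* THE LOWER BOUND in every finite abelian group (Kneser for `k` summands, the tree's `kneser_sum` = Nathanson
  Thm 4.4, applied to the sets `A_i + H`, `H = Stab(Σ A_i)`): `ekpTermK_card_addStab_le_card_sum`,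
  `exists_dvd_ekpTermK_le_card_sum`, **`ekpMuK_le_card_sum`** (`1 ≤ k`, all `A_i` non-empty);
* ATTAINMENT IN `ℤ/n` (sums of `k` coset progressions, `sum_cosetProg_subset`): `exists_card_sum_le_ekpTermK_zmod`,
  **`exists_card_sum_eq_ekpMuK_zmod`** — so `μ^{(k)}_{ℤ/n}(r₁,…,r_k) = ekpMuK n r` exactly;
* ATTAINMENT IN EVERY FINITE ABELIAN GROUP (appended the same day, section `General`): the small sumsets property
  for `k` summands `exists_card_sum_le_sum_sub` (`|Σ A_i| ≤ Σ r_i − k + 1`, induction on `|G|` along a surjection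
  onto `ℤ/m`, each `A_i` a "tower" of full fibres plus a partial fibre — the Eliahou–Kervaire–Plagne lifting of
  `OptimallySmallSumsets.lean`, `k`-fold), `exists_card_sum_le_ekpTermK` (every `d ∣ |G|`, via a subgroup of
  order `d` and preimages), **`exists_card_sum_eq_ekpMuK`** — so `μ^{(k)}_G(r₁,…,r_k) = ekpMuK |G| r` in EVERY
  finite abelian group, which is the printed formula (2) for finite `G`.
WHAT THIS FILE IS NOT: Plagne 2006 (the printed proof of (2), via the "supersmall sumsets property" along a
composition series) is not held — the attainment here is the EKP lifting construction iterated, a proof of the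
same statement, not a transcript of Plagne's; infinite abelian `G` (print: arbitrary abelian groups, `D` = orders
of finite subgroups) is not covered; nothing about Plagne's `ν_G^{(k)}` (unique representation) or non-abelian
groups; no statement about the cell's census.

## References
* A. Plagne, *Optimally small sumsets in groups III*, Funct. Approx. Comment. Math. 37 (2007) 377–397 — held
  `paper:doi-10-7169-facm-1229619661`, p0002 = p. 378 eq. (1) (definition of `μ_G^{(k)}`) and p0003 = p. 379 eq. (2)
  (the formula) read 2026-08-27 [cite: Plagne2007, p. 378 eq. (1)] [cite: Plagne2007, p. 379 eq. (2)].
* A. Plagne, *Optimally small sumsets in groups I. The supersmall sumsets property, the `μ_G^{(k)}` and the `ν_G^{(k)}`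
  functions*, Unif. Distrib. Theory 1 (2006) 27–44 (the proof of eq. (2); not held, statement via the 2007 restatement).
* M. B. Nathanson, *Additive Number Theory: Inverse Problems*, GTM 165, Thm 4.4 — tree `kneser_sum`
  [cite: Nathanson1996, Thm 4.4].
-/

namespace Literature.Combinatorics.Additive

open Finset
open scoped Pointwise

/-! ## The `k`-summand Eliahou–Kervaire–Plagne function -/

/-- `ekpTermK d (r₁,…,r_k) = d·(⌈r₁/d⌉ + ⋯ + ⌈r_k/d⌉) − (k − 1)·d = (Σ⌈r_i/d⌉ − k + 1)·d`: the size of a sum of `k`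
coset progressions of `⌈r_i/d⌉` cosets of a subgroup of order `d`. [cite: Plagne2007, p. 379 eq. (2)] -/
def ekpTermK (d : ℕ) {k : ℕ} (r : Fin k → ℕ) : ℕ := d * (∑ i, (r i + d - 1) / d) - (k - 1) * d

/-- Plagne's `μ^{(k)}(n; r₁,…,r_k) = min_{d ∣ n} (Σ⌈r_i/d⌉ − k + 1)·d` for a group order `n ≥ 1` (`0` for `n = 0`).
[cite: Plagne2007, p. 378 eq. (1)] [cite: Plagne2007, p. 379 eq. (2)] -/
def ekpMuK (n : ℕ) {k : ℕ} (r : Fin k → ℕ) : ℕ :=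
  if h : n = 0 then 0 else (n.divisors).inf' (Nat.nonempty_divisors.2 h) (fun d => ekpTermK d r)

/-- Unfolding of `ekpTermK`. [cite: Plagne2007, p. 379 eq. (2)] -/
theorem ekpTermK_def (d : ℕ) {k : ℕ} (r : Fin k → ℕ) :
    ekpTermK d r = d * (∑ i, (r i + d - 1) / d) - (k - 1) * d := rfl

/-- Consistency with the two-summand function of `OptimallySmallSumsets.lean`: `ekpTermK d (r, s) = ekpTerm d r s`.
[cite: Plagne2007, p. 379 eq. (2)] -/
theorem ekpTermK_two (d r s : ℕ) : ekpTermK d ![r, s] = ekpTerm d r s := by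
  rw [ekpTermK_def, ekpTerm_def, Fin.sum_univ_two]
  simp

/-- Junk value at `n = 0`. [cite: Plagne2007, p. 379 eq. (2)] -/
theorem ekpMuK_zero {k : ℕ} (r : Fin k → ℕ) : ekpMuK 0 r = 0 := by simp [ekpMuK]

/-- Unfolding of `ekpMuK` for `n ≥ 1`. [cite: Plagne2007, p. 379 eq. (2)] -/
theorem ekpMuK_of_ne_zero {n : ℕ} (hn : n ≠ 0) {k : ℕ} (r : Fin k → ℕ) :
    ekpMuK n r = (n.divisors).inf' (Nat.nonempty_divisors.2 hn) (fun d => ekpTermK d r) := by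
  simp [ekpMuK, hn]

/-- `μ^{(k)} ≤` each term. [cite: Plagne2007, p. 379 eq. (2)] -/
theorem ekpMuK_le_ekpTermK {n d : ℕ} (hn : n ≠ 0) (hd : d ∣ n) {k : ℕ} (r : Fin k → ℕ) :
    ekpMuK n r ≤ ekpTermK d r := by
  rw [ekpMuK_of_ne_zero hn]
  exact Finset.inf'_le _ (Nat.mem_divisors.2 ⟨hd, hn⟩)

/-- The minimum is attained at a positive divisor. [cite: Plagne2007, p. 379 eq. (2)] -/
theorem exists_dvd_ekpMuK_eq {n : ℕ} (hn : n ≠ 0) {k : ℕ} (r : Fin k → ℕ) :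
    ∃ d : ℕ, d ∣ n ∧ 0 < d ∧ ekpMuK n r = ekpTermK d r := by
  rw [ekpMuK_of_ne_zero hn]
  obtain ⟨d, hd, heq⟩ := Finset.exists_mem_eq_inf' (Nat.nonempty_divisors.2 hn) (fun d => ekpTermK d r)
  exact ⟨d, Nat.dvd_of_mem_divisors hd, Nat.pos_of_mem_divisors hd, heq⟩

/-- Lower bounds on every term bound `μ^{(k)}`. [cite: Plagne2007, p. 379 eq. (2)] -/
theorem le_ekpMuK {n m : ℕ} (hn : n ≠ 0) {k : ℕ} (r : Fin k → ℕ)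
    (h : ∀ d : ℕ, d ∣ n → 0 < d → m ≤ ekpTermK d r) : m ≤ ekpMuK n r := by
  rw [ekpMuK_of_ne_zero hn]
  exact Finset.le_inf' _ _ (fun d hd => h d (Nat.dvd_of_mem_divisors hd) (Nat.pos_of_mem_divisors hd))

/-! ## Small private tools -/

/-- If `d ∣ x` and `a ≤ x` then `d·⌈a/d⌉ ≤ x`. [folklore] -/
private theorem mul_ceilDiv_le_of_dvd_of_le' {d x a : ℕ} (hd : 0 < d) (hdx : d ∣ x) (hax : a ≤ x) :
    d * ((a + d - 1) / d) ≤ x := by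
  obtain ⟨q, rfl⟩ := hdx
  refine Nat.mul_le_mul_left d ?_
  have h1 : (a + d - 1) / d < q + 1 := by
    rw [Nat.div_lt_iff_lt_mul hd, Nat.succ_mul]
    have : d * q = q * d := Nat.mul_comm d q
    omega
  omega

/-- `a ≤ d·⌈a/d⌉`. [folklore] -/
private theorem le_mul_ceilDiv' {d : ℕ} (hd : 0 < d) (a : ℕ) : a ≤ d * ((a + d - 1) / d) := by
  have h := Nat.lt_div_mul_add (a := a + d - 1) hd
  have : (a + d - 1) / d * d = d * ((a + d - 1) / d) := Nat.mul_comm _ _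
  omega

/-- `⌈a/d⌉ ≤ m` when `a ≤ m·d`. [folklore] -/
private theorem ceilDiv_le_of_le_mul' {d m a : ℕ} (hd : 0 < d) (h : a ≤ m * d) : (a + d - 1) / d ≤ m := by
  have h1 : (a + d - 1) / d < m + 1 := by
    rw [Nat.div_lt_iff_lt_mul hd, Nat.succ_mul]
    omega
  omega

variable {G : Type*} [AddCommGroup G] [DecidableEq G]

/-- A sum of non-empty finsets is non-empty. [folklore] -/
private theorem sum_nonempty' : ∀ {h : ℕ} (A : Fin h → Finset G), (∀ i, (A i).Nonempty) →
    (∑ i, A i).Nonempty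
  | 0, A, _ => by simp
  | h + 1, A, hA => by
    rw [Fin.sum_univ_castSucc]
    exact (sum_nonempty' (fun i => A (Fin.castSucc i)) fun i => hA _).add (hA _)

/-- `n • H = H` for `n ≥ 1` when `H + H = H`. [folklore] -/
private theorem nsmul_eq_self_of_add_self' {H : Finset G} (hH : H + H = H) :
    ∀ {n : ℕ}, 1 ≤ n → n • H = H
  | 0, h => absurd h (by norm_num)
  | 1, _ => one_nsmul H
  | n + 2, _ => by
    rw [succ_nsmul, nsmul_eq_self_of_add_self' hH (n := n + 1) (by omega), hH]

/-- Sums are monotone for pointwise addition of finsets. [folklore] -/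
private theorem sum_subset_sum' : ∀ {k : ℕ} {A B : Fin k → Finset G}, (∀ i, A i ⊆ B i) → ∑ i, A i ⊆ ∑ i, B i
  | 0, _, _, _ => by simp
  | k + 1, A, B, h => by
    rw [Fin.sum_univ_castSucc, Fin.sum_univ_castSucc]
    exact add_subset_add (sum_subset_sum' fun i => h _) (h _)

/-! ## The lower bound (Kneser half), any finite abelian group -/

section LowerBound

/-- **Plagne's lower bound at the stabiliser.**  For `k ≥ 1` non-empty finite sets `A_i` in an abelian group and
`d = |Stab(Σ A_i)|`: `d·Σ⌈|A_i|/d⌉ − (k−1)·d ≤ |Σ A_i|` — Kneser for `k` summands applied to the sets `A_i + H`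
(each a union of `H`-cosets containing `A_i`, their sum again `Σ A_i`).
[cite: Plagne2007, p. 379 eq. (2) (lower bound, via Kneser)] -/
theorem ekpTermK_card_addStab_le_card_sum {k : ℕ} (hk : 1 ≤ k) (A : Fin k → Finset G)
    (hA : ∀ i, (A i).Nonempty) : ekpTermK #(∑ i, A i).addStab (fun i => #(A i)) ≤ #(∑ i, A i) := by
  classical
  set S : Finset G := ∑ i, A i with hS
  have hSne : S.Nonempty := sum_nonempty' A hA
  have hHne : S.addStab.Nonempty := hSne.addStab
  have h0H : (0 : G) ∈ S.addStab := hSne.zero_mem_addStab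
  have hd : 0 < #S.addStab := hHne.card_pos
  -- the family `A_i + H` sums to `S` again
  have hsum : ∑ i, (A i + S.addStab) = S := by
    rw [Finset.sum_add_distrib, sum_const, card_univ, Fintype.card_fin,
      nsmul_eq_self_of_add_self' (addStab_add_addStab S) hk]
    exact add_addStab S
  have hkn := kneser_sum (fun i => A i + S.addStab) fun i => (hA i).add hHne
  rw [hsum] at hkn
  -- each `A_i + H` is a union of cosets covering `A_i`
  have hterm : ∀ i, #S.addStab * ((#(A i) + #S.addStab - 1) / #S.addStab) ≤ #(A i + S.addStab) := fun i =>
    mul_ceilDiv_le_of_dvd_of_le' hd (card_addStab_dvd_card_add_addStab (A i) S)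
      (card_le_card (subset_add_left (A i) h0H))
  have hle : #S.addStab * ∑ i, (#(A i) + #S.addStab - 1) / #S.addStab ≤ ∑ i, #(A i + S.addStab) := by
    rw [mul_sum]
    exact sum_le_sum fun i _ => hterm i
  have hmain : #S.addStab * ∑ i, (#(A i) + #S.addStab - 1) / #S.addStab ≤ #S + (k - 1) * #S.addStab :=
    hle.trans hkn
  rw [ekpTermK_def]
  omega

/-- **Divisor form.**  In a FINITE abelian group, for `k ≥ 1` non-empty `A_i` there is a divisor `d` of `|G|`
(the order of `Stab(Σ A_i)`) with `(Σ⌈|A_i|/d⌉ − k + 1)·d ≤ |Σ A_i|`. [cite: Plagne2007, p. 379 eq. (2)] -/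
theorem exists_dvd_ekpTermK_le_card_sum [Fintype G] {k : ℕ} (hk : 1 ≤ k) (A : Fin k → Finset G)
    (hA : ∀ i, (A i).Nonempty) :
    ∃ d : ℕ, d ∣ Fintype.card G ∧ 0 < d ∧ ekpTermK d (fun i => #(A i)) ≤ #(∑ i, A i) :=
  ⟨#(∑ i, A i).addStab, (sum_nonempty' A hA).card_addStab_dvd_card_univ,
    (sum_nonempty' A hA).addStab.card_pos, ekpTermK_card_addStab_le_card_sum hk A hA⟩

/-- **Plagne's lower bound: `μ_G^{(k)}(|A₁|,…,|A_k|) ≤ |A₁ + ⋯ + A_k|`** for `k ≥ 1` non-empty sets in a finite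
abelian group `G`. [cite: Plagne2007, p. 379 eq. (2)] -/
theorem ekpMuK_le_card_sum [Fintype G] {k : ℕ} (hk : 1 ≤ k) (A : Fin k → Finset G)
    (hA : ∀ i, (A i).Nonempty) : ekpMuK (Fintype.card G) (fun i => #(A i)) ≤ #(∑ i, A i) := by
  obtain ⟨d, hd, hdpos, hle⟩ := exists_dvd_ekpTermK_le_card_sum hk A hA
  exact (ekpMuK_le_ekpTermK Fintype.card_ne_zero hd _).trans hle

end LowerBound

/-! ## Attainment in `ℤ/n`: sums of `k` coset progressions -/

section Cyclic

variable {n : ℕ}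

/-- Coset progressions grow with the number of cosets. [cite: EliahouKervairePlagne2003, main Thm (construction)] -/
theorem cosetProg_mono {m d k l : ℕ} (h : k ≤ l) : cosetProg n m d k ⊆ cosetProg n m d l := by
  intro x hx
  rw [mem_cosetProg] at hx ⊢
  obtain ⟨i, j, hi, hj, hx⟩ := hx
  exact ⟨i, j, lt_of_lt_of_le hi h, hj, hx⟩

/-- **Sums of `k` coset progressions**: `Σ_i (P_{c_i} + H) ⊆ P_{Σ c_i − (k−1)} + H` in `ℤ/n`, `n = m·d`, all
`c_i ≥ 1`. [cite: Plagne2007, p. 379 eq. (2) (construction)] -/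
theorem sum_cosetProg_subset {m d : ℕ} (hmd : m * d = n) (k : ℕ) :
    ∀ (c : Fin (k + 1) → ℕ), (∀ i, 1 ≤ c i) →
      ∑ i, cosetProg n m d (c i) ⊆ cosetProg n m d (∑ i, c i - k) := by
  induction k with
  | zero =>
    intro c _
    simp
  | succ k ih =>
    intro c hc
    rw [Fin.sum_univ_castSucc (f := fun i => cosetProg n m d (c i)), Fin.sum_univ_castSucc (f := c)]
    have ih' := ih (fun i => c (Fin.castSucc i)) fun i => hc _
    refine (add_subset_add ih' subset_rfl).trans ((cosetProg_add_cosetProg_subset hmd).trans (cosetProg_mono ?_))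
    have h1 : k + 1 ≤ ∑ i : Fin (k + 1), c (Fin.castSucc i) := by
      have := Finset.card_nsmul_le_sum (univ : Finset (Fin (k + 1))) (fun i => c (Fin.castSucc i)) 1
        fun i _ => hc _
      simpa using this
    have h2 := hc (Fin.last (k + 1))
    omega

/-- **Plagne's upper bound in `ℤ/n` (the construction).**  For `d ∣ n`, `k ≥ 1` and `1 ≤ r_i ≤ n` there are
`A_i ⊆ ℤ/n` with `|A_i| = r_i` and `|Σ A_i| ≤ (Σ⌈r_i/d⌉ − k + 1)·d`: each `A_i` inside `⌈r_i/d⌉` consecutive cosets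
of the subgroup of order `d`. [cite: Plagne2007, p. 379 eq. (2)] -/
theorem exists_card_sum_le_ekpTermK_zmod {d : ℕ} (hdn : d ∣ n) {k : ℕ} (hk : 1 ≤ k) (r : Fin k → ℕ)
    (hr : ∀ i, 1 ≤ r i) (hrn : ∀ i, r i ≤ n) :
    ∃ A : Fin k → Finset (ZMod n), (∀ i, #(A i) = r i) ∧ #(∑ i, A i) ≤ ekpTermK d r := by
  classical
  obtain ⟨k, rfl⟩ : ∃ j, k = j + 1 := ⟨k - 1, by omega⟩
  obtain ⟨m, hnm⟩ := hdn
  have hn : 0 < n := lt_of_lt_of_le (hr 0) (hrn 0)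
  have hd : 0 < d := Nat.pos_of_ne_zero (by rintro rfl; simp at hnm; omega)
  have hmd : m * d = n := by rw [hnm, mul_comm]
  have hc1 : ∀ i, 1 ≤ (r i + d - 1) / d := fun i => by
    rw [Nat.le_div_iff_mul_le hd]; have := hr i; omega
  have hcm : ∀ i, (r i + d - 1) / d ≤ m := fun i => ceilDiv_le_of_le_mul' hd (by rw [hmd]; exact hrn i)
  have hri : ∀ i, r i ≤ #(cosetProg n m d ((r i + d - 1) / d)) := fun i => by
    rw [card_cosetProg hmd (hcm i), mul_comm]; exact le_mul_ceilDiv' hd (r i)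
  have hAi : ∀ i, ∃ A : Finset (ZMod n), A ⊆ cosetProg n m d ((r i + d - 1) / d) ∧ #A = r i := fun i =>
    exists_subset_card_eq (hri i)
  choose A hAsub hAcard using hAi
  refine ⟨A, hAcard, ?_⟩
  calc #(∑ i, A i) ≤ #(∑ i, cosetProg n m d ((r i + d - 1) / d)) := card_le_card (sum_subset_sum' hAsub)
    _ ≤ #(cosetProg n m d (∑ i, (r i + d - 1) / d - k)) :=
        card_le_card (sum_cosetProg_subset hmd k (fun i => (r i + d - 1) / d) hc1)
    _ ≤ (∑ i, (r i + d - 1) / d - k) * d := card_cosetProg_le _ _ _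
    _ = ekpTermK d r := by rw [ekpTermK_def, mul_comm d, Nat.add_sub_cancel, Nat.sub_mul]

/-- **Plagne's formula in cyclic groups: `μ^{(k)}_{ℤ/n}(r₁,…,r_k) = min_{d ∣ n} (Σ⌈r_i/d⌉ − k + 1)·d`.**  For `k ≥ 1`
and `1 ≤ r_i ≤ n` there are `A_i ⊆ ℤ/n` with `|A_i| = r_i` and `|Σ A_i| = ekpMuK n r`; with `ekpMuK_le_card_sum` the
minimum of `|A₁ + ⋯ + A_k|` over such families is exactly `ekpMuK n r`. [cite: Plagne2007, p. 379 eq. (2)] -/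
theorem exists_card_sum_eq_ekpMuK_zmod {k : ℕ} (hk : 1 ≤ k) (r : Fin k → ℕ) (hr : ∀ i, 1 ≤ r i)
    (hrn : ∀ i, r i ≤ n) : ∃ A : Fin k → Finset (ZMod n), (∀ i, #(A i) = r i) ∧ #(∑ i, A i) = ekpMuK n r := by
  have hn : n ≠ 0 := by have := lt_of_lt_of_le (hr ⟨0, by omega⟩) (hrn ⟨0, by omega⟩); omega
  haveI : NeZero n := ⟨hn⟩
  obtain ⟨d, hd, hdpos, hmu⟩ := exists_dvd_ekpMuK_eq hn r
  obtain ⟨A, hA, hle⟩ := exists_card_sum_le_ekpTermK_zmod hd hk r hr hrn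
  refine ⟨A, hA, le_antisymm (hmu ▸ hle) ?_⟩
  have hAne : ∀ i, (A i).Nonempty := fun i => card_pos.1 (by rw [hA i]; exact hr i)
  have h := ekpMuK_le_card_sum hk A hAne
  rw [ZMod.card] at h
  have hfun : (fun i => #(A i)) = r := funext hA
  rwa [hfun] at h

/-- The lower bound in `ℤ/n` by name: `ekpMuK n (|A_i|)_i ≤ |Σ A_i|`. [cite: Plagne2007, p. 379 eq. (2)] -/
theorem ekpMuK_le_card_sum_zmod [NeZero n] {k : ℕ} (hk : 1 ≤ k) (A : Fin k → Finset (ZMod n))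
    (hA : ∀ i, (A i).Nonempty) : ekpMuK n (fun i => #(A i)) ≤ #(∑ i, A i) := by
  have h := ekpMuK_le_card_sum hk A hA
  rwa [ZMod.card] at h

end Cyclic

/-! ## Attainment in every finite abelian group (appended 2026-08-27, gen 10): the EKP lifting construction
for `k` summands — Plagne's formula (2) for every finite abelian `G` (`exists_card_sum_eq_ekpMuK`) -/

section General

variable {G : Type*} [AddCommGroup G] [DecidableEq G]

/-! ### Arithmetic of `r = (c − 1)κ + ρ`, `c = ⌈r/κ⌉`, `1 ≤ ρ ≤ κ` -/

/-- The decomposition `r = (⌈r/κ⌉ − 1)κ + ρ` with `1 ≤ ρ ≤ κ` and `⌈r/κ⌉ ≤ M` when `r ≤ Mκ`. [folklore] -/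
private theorem ceil_decomp {κ r M : ℕ} (hκ : 0 < κ) (hr : 1 ≤ r) (hrM : r ≤ M * κ) :
    1 ≤ (r + κ - 1) / κ ∧ (r + κ - 1) / κ ≤ M ∧ 1 ≤ r - ((r + κ - 1) / κ - 1) * κ ∧
      r - ((r + κ - 1) / κ - 1) * κ ≤ κ ∧ ((r + κ - 1) / κ - 1) * κ + (r - ((r + κ - 1) / κ - 1) * κ) = r := by
  obtain ⟨c, hc⟩ : ∃ c, (r + κ - 1) / κ = c := ⟨_, rfl⟩
  rw [hc]
  have h1 : r ≤ c * κ := by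
    have h := Nat.lt_div_mul_add (a := r + κ - 1) hκ
    rw [hc] at h
    have : c * κ + κ = (c + 1) * κ := by ring
    omega
  have h2 : c * κ ≤ r + κ - 1 := by
    have h := Nat.div_mul_le_self (r + κ - 1) κ
    rw [hc] at h; exact h
  have hc1 : 1 ≤ c := by rw [← hc, Nat.one_le_div_iff hκ]; omega
  have hcM : c ≤ M := by
    rw [← hc, ← Nat.lt_add_one_iff, Nat.div_lt_iff_lt_mul hκ, Nat.succ_mul]
    omega
  have hcκ : (c - 1) * κ = c * κ - κ := Nat.sub_one_mul c κ
  have hκc : κ ≤ c * κ := Nat.le_mul_of_pos_left κ hc1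
  refine ⟨hc1, hcM, ?_, ?_, ?_⟩ <;> omega

/-! ### Sums of finsets: two private tools -/

/-- Images under an additive homomorphism commute with finset sums of finsets. [folklore] -/
private theorem image_sum_addMonoidHom {H : Type*} [AddCommGroup H] [DecidableEq H] (f : H →+ G) :
    ∀ (k : ℕ) (X : Fin k → Finset H), (∑ i, X i).image f = ∑ i, (X i).image f
  | 0, X => by simp [Finset.singleton_zero]
  | k + 1, X => by
    rw [Fin.sum_univ_castSucc (f := X), Fin.sum_univ_castSucc (f := fun i => (X i).image f), image_add,
      image_sum_addMonoidHom f k]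

/-- A sum of subsets of an additively closed set containing `0` stays inside it. [folklore] -/
private theorem sum_subset_of_forall_subset {K : Finset G} (hK0 : (0 : G) ∈ K)
    (hKadd : ∀ x ∈ K, ∀ y ∈ K, x + y ∈ K) :
    ∀ (k : ℕ) (X : Fin k → Finset G), (∀ i, X i ⊆ K) → ∑ i, X i ⊆ K
  | 0, X, _ => by simpa using hK0
  | k + 1, X, hX => by
    rw [Fin.sum_univ_castSucc (f := X)]
    exact add_subset_iff.2 fun x hx y hy =>
      hKadd x (sum_subset_of_forall_subset hK0 hKadd k _ (fun i => hX _) hx) y (hX _ hy)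

/-! ### Towers: `c` full translates of `K` and one partial translate -/

/-- `tower g K N X = ⋃_{c < N} (c•g + K) ∪ (N•g + X)`: `N` consecutive translates of `K` along `g` followed by a
translate of the partial set `X`. [folklore] -/
private def tower (g : G) (K : Finset G) (N : ℕ) (X : Finset G) : Finset G :=
  ((range N).biUnion fun c => (c • g) +ᵥ K) ∪ ((N • g) +ᵥ X)

/-- Membership in a tower. [folklore] -/
private theorem mem_tower {g : G} {K : Finset G} {N : ℕ} {X : Finset G} {z : G} :
    z ∈ tower g K N X ↔ (∃ c x, c < N ∧ x ∈ K ∧ z = c • g + x) ∨ ∃ x ∈ X, z = N • g + x := by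
  simp only [tower, mem_union, mem_biUnion, mem_range, mem_vadd_finset, vadd_eq_add]
  constructor
  · rintro (⟨c, hc, x, hx, rfl⟩ | ⟨x, hx, rfl⟩)
    · exact Or.inl ⟨c, x, hc, hx, rfl⟩
    · exact Or.inr ⟨x, hx, rfl⟩
  · rintro (⟨c, x, hc, hx, rfl⟩ | ⟨x, hx, rfl⟩)
    · exact Or.inl ⟨c, hc, x, hx, rfl⟩
    · exact Or.inr ⟨x, hx, rfl⟩

/-- Towers add: `T(N₁, X₁) + T(N₂, X₂) ⊆ T(N₁ + N₂, X₁ + X₂)` when `K + K ⊆ K` and `X₁, X₂ ⊆ K`. [folklore] -/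
private theorem tower_add_tower_subset (g : G) {K : Finset G} (hKadd : ∀ x ∈ K, ∀ y ∈ K, x + y ∈ K)
    {N₁ N₂ : ℕ} {X₁ X₂ : Finset G} (hX₁ : X₁ ⊆ K) (hX₂ : X₂ ⊆ K) :
    tower g K N₁ X₁ + tower g K N₂ X₂ ⊆ tower g K (N₁ + N₂) (X₁ + X₂) := by
  intro z hz
  rw [mem_add] at hz
  obtain ⟨x, hx, y, hy, rfl⟩ := hz
  rw [mem_tower] at hx hy ⊢
  rcases hx with ⟨c₁, x₁, hc₁, hx₁, rfl⟩ | ⟨x₁, hx₁, rfl⟩ <;>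
    rcases hy with ⟨c₂, x₂, hc₂, hx₂, rfl⟩ | ⟨x₂, hx₂, rfl⟩
  · refine Or.inl ⟨c₁ + c₂, x₁ + x₂, by omega, hKadd _ hx₁ _ hx₂, ?_⟩
    rw [add_nsmul]; abel
  · refine Or.inl ⟨c₁ + N₂, x₁ + x₂, by omega, hKadd _ hx₁ _ (hX₂ hx₂), ?_⟩
    rw [add_nsmul]; abel
  · refine Or.inl ⟨N₁ + c₂, x₁ + x₂, by omega, hKadd _ (hX₁ hx₁) _ hx₂, ?_⟩
    rw [add_nsmul]; abel
  · refine Or.inr ⟨x₁ + x₂, add_mem_add hx₁ hx₂, ?_⟩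
    rw [add_nsmul]; abel

/-- Sums of towers: `Σ T(N_i, X_i) ⊆ T(Σ N_i, Σ X_i)`. [folklore] -/
private theorem sum_tower_subset (g : G) {K : Finset G} (hK0 : (0 : G) ∈ K)
    (hKadd : ∀ x ∈ K, ∀ y ∈ K, x + y ∈ K) :
    ∀ (k : ℕ) (N : Fin k → ℕ) (X : Fin k → Finset G), (∀ i, X i ⊆ K) →
      ∑ i, tower g K (N i) (X i) ⊆ tower g K (∑ i, N i) (∑ i, X i)
  | 0, N, X, _ => by
    intro z hz
    rw [mem_tower]
    refine Or.inr ⟨0, ?_, ?_⟩ <;> simp_all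
  | k + 1, N, X, hX => by
    rw [Fin.sum_univ_castSucc (f := fun i => tower g K (N i) (X i)), Fin.sum_univ_castSucc (f := N),
      Fin.sum_univ_castSucc (f := X)]
    exact (add_subset_add (sum_tower_subset g hK0 hKadd k _ _ fun i => hX _) subset_rfl).trans
      (tower_add_tower_subset g hKadd
        (sum_subset_of_forall_subset hK0 hKadd k _ fun i => hX _) (hX _))

/-- The size of a tower is at most `N|K| + |X|`. [folklore] -/
private theorem card_tower_le (g : G) (K : Finset G) (N : ℕ) (X : Finset G) :
    #(tower g K N X) ≤ N * #K + #X := by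
  unfold tower
  refine (card_union_le _ _).trans (add_le_add (card_biUnion_le.trans ?_) (card_vadd_finset _ _).le)
  rw [sum_congr rfl fun c _ => card_vadd_finset (c • g) K, sum_const, card_range, smul_eq_mul]

/-- The size of a tower is exactly `N|K| + |X|` when a homomorphism `ψ` onto `ℤ/m` kills `K`, `ψ g = 1`,
`X ⊆ K` and `N + 1 ≤ m` (the `N + 1` translates lie in distinct fibres). [folklore] -/
private theorem card_tower_eq {m : ℕ} [NeZero m] (ψ : G →+ ZMod m) {g : G} (hg : ψ g = 1) {K : Finset G}
    (hK : ∀ x ∈ K, ψ x = 0) {N : ℕ} (hN : N + 1 ≤ m) {X : Finset G} (hX : X ⊆ K) :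
    #(tower g K N X) = N * #K + #X := by
  have hψ : ∀ (c : ℕ) {x : G}, x ∈ K → ψ (c • g + x) = (c : ZMod m) := by
    intro c x hx
    rw [map_add, map_nsmul, hg, hK x hx, add_zero, Nat.smul_one_eq_cast]
  have cast_inj : ∀ {i j : ℕ}, i < m → j < m → (i : ZMod m) = (j : ZMod m) → i = j := by
    intro i j hi hj h
    rwa [ZMod.natCast_eq_natCast_iff', Nat.mod_eq_of_lt hi, Nat.mod_eq_of_lt hj] at h
  unfold tower
  rw [card_union_of_disjoint, card_biUnion, sum_congr rfl fun c _ => card_vadd_finset (c • g) K, sum_const,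
    card_range, smul_eq_mul, card_vadd_finset]
  · intro c hc d hd hcd
    rw [Function.onFun, disjoint_left]
    intro z hzc hzd
    rw [mem_vadd_finset] at hzc hzd
    obtain ⟨x, hx, rfl⟩ := hzc
    obtain ⟨y, hy, hxy⟩ := hzd
    have h1 := hψ c hx
    simp only [vadd_eq_add] at hxy
    rw [← hxy, hψ d hy] at h1
    rw [coe_range, Set.mem_Iio] at hc hd
    exact hcd (cast_inj (by omega) (by omega) h1).symm
  · rw [disjoint_left]
    intro z hz hzX
    rw [mem_biUnion] at hz
    obtain ⟨c, hc, hzc⟩ := hz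
    rw [mem_range] at hc
    rw [mem_vadd_finset] at hzc hzX
    obtain ⟨x, hx, rfl⟩ := hzc
    obtain ⟨y, hy, hxy⟩ := hzX
    have h1 := hψ c hx
    simp only [vadd_eq_add] at hxy
    rw [← hxy, hψ N (hX hy)] at h1
    have := cast_inj (by omega) (by omega) h1
    omega

/-! ### A surjection onto a non-trivial cyclic group -/

omit [DecidableEq G] in
/-- A non-trivial finite abelian group maps onto `ℤ/m` for some `m ≥ 2` (a factor of the invariant-factor
decomposition). [folklore] -/
private theorem exists_surjective_zmod' [Fintype G] (hG : 1 < Fintype.card G) :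
    ∃ (m : ℕ) (ψ : G →+ ZMod m), 1 < m ∧ Function.Surjective ψ := by
  obtain ⟨t, m, hm, -, ⟨e⟩⟩ := Literature.GroupTheory.FiniteAbelian.exists_addEquiv_pi_zmod_chain_of_finite G
  rcases Nat.eq_zero_or_pos t with rfl | ht
  · exfalso
    have h1 : Fintype.card G = 1 := by
      rw [Fintype.card_congr e.toEquiv]
      exact Fintype.card_eq_one_iff.2 ⟨fun j => Fin.elim0 j, fun f => funext fun j => Fin.elim0 j⟩
    omega
  refine ⟨m ⟨0, ht⟩, (Pi.evalAddMonoidHom (fun j => ZMod (m j)) ⟨0, ht⟩).comp e.toAddMonoidHom,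
    hm _, ?_⟩
  intro c
  refine ⟨e.symm (Pi.single (⟨0, ht⟩ : Fin t) c), ?_⟩
  simp

/-! ### The small sumsets property for `k` summands -/

/-- **Small sumsets property for `k` summands (Plagne; the `d = 1` term of `μ_G^{(k)}`).**  In a finite abelian
group of order `n`, for `k ≥ 1` and `1 ≤ r_i ≤ n` there are `A_i` with `|A_i| = r_i` and
`|A₁ + ⋯ + A_k| ≤ r₁ + ⋯ + r_k − k + 1`.  Proof: induction on `n` along a surjection `ψ : G → ℤ/m`, `m ≥ 2`,
each `A_i` a tower of `⌈r_i/κ⌉ − 1` full fibres plus a partial fibre carrying the sets given by the inductive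
hypothesis in `ker ψ` (`κ = |ker ψ|`) — the Eliahou–Kervaire–Plagne lifting, `k`-fold.
[cite: Plagne2007, p. 379 eq. (2)] [cite: EliahouKervairePlagne2003, main Thm (construction)] -/
theorem exists_card_sum_le_sum_sub :
    ∀ (n : ℕ) (G : Type*) [AddCommGroup G] [Fintype G] [DecidableEq G], Fintype.card G = n →
      ∀ (k : ℕ) (r : Fin k → ℕ), 1 ≤ k → (∀ i, 1 ≤ r i) → (∀ i, r i ≤ n) →
        ∃ A : Fin k → Finset G, (∀ i, #(A i) = r i) ∧ #(∑ i, A i) ≤ ∑ i, r i - (k - 1) := by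
  intro n
  induction n using Nat.strong_induction_on with
  | _ n ih =>
  intro G _ _ _ hn k r hk hr hrn
  classical
  have hkr : k ≤ ∑ i, r i := by
    have := Finset.card_nsmul_le_sum (univ : Finset (Fin k)) r 1 fun i _ => hr i
    simpa using this
  by_cases h1 : n = 1
  · -- trivial group: all `r_i = 1`, all `A_i = {0}`
    subst h1
    refine ⟨fun _ => {0}, fun i => ?_, ?_⟩
    · rw [card_singleton]; have := hr i; have := hrn i; omega
    · show #(∑ _i : Fin k, ({0} : Finset G)) ≤ _
      have : #(∑ _i : Fin k, ({0} : Finset G)) ≤ 1 := (card_le_univ _).trans hn.le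
      omega
  have hn1 : 1 < n := by
    have : 0 < Fintype.card G := Fintype.card_pos
    omega
  obtain ⟨m, ψ, hm, hψ⟩ := exists_surjective_zmod' (G := G) (hn ▸ hn1)
  haveI : NeZero m := ⟨by omega⟩
  obtain ⟨g, hg⟩ := hψ 1
  -- the kernel as a finset `K` of `G`, its order `κ`, and `|G| = m κ`
  set K : Finset G := univ.filter fun x => ψ x = 0 with hKdef
  have hK : ∀ x ∈ K, ψ x = 0 := fun x hx => (mem_filter.1 hx).2
  have hK0 : (0 : G) ∈ K := mem_filter.2 ⟨mem_univ _, map_zero ψ⟩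
  have hKadd : ∀ x ∈ K, ∀ y ∈ K, x + y ∈ K := fun x hx y hy =>
    mem_filter.2 ⟨mem_univ _, by rw [map_add, hK x hx, hK y hy, add_zero]⟩
  haveI : Fintype ψ.ker := Fintype.ofFinite _
  obtain ⟨κ, hκ⟩ : ∃ κ, Fintype.card ψ.ker = κ := ⟨_, rfl⟩
  have hKκ : #K = κ := by
    rw [← hκ, ← Nat.card_eq_fintype_card,
      Nat.card_congr (Equiv.subtypeEquivRight (fun x => AddMonoidHom.mem_ker) : ψ.ker ≃ {x : G // ψ x = 0}),
      Nat.card_eq_fintype_card, Fintype.card_subtype]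
  have hGκ : Fintype.card G = m * κ := by
    have h := ψ.ker.card_eq_card_quotient_mul_card_addSubgroup
    rw [Nat.card_congr (QuotientAddGroup.quotientKerEquivOfSurjective ψ hψ).toEquiv, Nat.card_zmod,
      Nat.card_eq_fintype_card, Nat.card_eq_fintype_card, hκ] at h
    exact h
  have hκpos : 0 < κ := by rw [← hKκ]; exact card_pos.2 ⟨0, hK0⟩
  have hκn : κ < n := by
    rw [← hn, hGκ]
    have : 1 * κ < m * κ := Nat.mul_lt_mul_of_pos_right hm hκpos
    omega
  -- sizes `r_i = (c_i − 1)κ + ρ_i`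
  have hdec := fun i => ceil_decomp (M := m) hκpos (hr i) (by rw [← hGκ, hn]; exact hrn i)
  set c : Fin k → ℕ := fun i => (r i + κ - 1) / κ with hc
  set ρ : Fin k → ℕ := fun i => r i - (c i - 1) * κ with hρ
  have hc1 : ∀ i, 1 ≤ c i := fun i => (hdec i).1
  have hcm : ∀ i, c i ≤ m := fun i => (hdec i).2.1
  have hρ1 : ∀ i, 1 ≤ ρ i := fun i => (hdec i).2.2.1
  have hρκ : ∀ i, ρ i ≤ κ := fun i => (hdec i).2.2.2.1
  have hrρ : ∀ i, (c i - 1) * κ + ρ i = r i := fun i => (hdec i).2.2.2.2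
  -- the kernel has the property by induction
  obtain ⟨X', hX', hX'sum⟩ := ih κ hκn ψ.ker hκ k ρ hk hρ1 hρκ
  let X : Fin k → Finset G := fun i => (X' i).image ψ.ker.subtype
  have hXK : ∀ i, X i ⊆ K := by
    intro i z hz
    obtain ⟨p, _, rfl⟩ := mem_image.1 hz
    exact mem_filter.2 ⟨mem_univ _, (AddMonoidHom.mem_ker).1 p.2⟩
  have hXcard : ∀ i, #(X i) = ρ i := fun i => by
    show #((X' i).image ψ.ker.subtype) = ρ i
    rw [card_image_of_injective _ ψ.ker.subtype_injective, hX' i]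
  have hXsum : #(∑ i, X i) ≤ ∑ i, ρ i - (k - 1) := by
    show #(∑ i, (X' i).image ψ.ker.subtype) ≤ _
    rw [← image_sum_addMonoidHom ψ.ker.subtype k X', card_image_of_injective _ ψ.ker.subtype_injective]
    exact hX'sum
  -- the sets: towers
  refine ⟨fun i => tower g K (c i - 1) (X i), fun i => ?_, ?_⟩
  · rw [card_tower_eq ψ hg hK (by have := hc1 i; have := hcm i; omega) (hXK i), hKκ, hXcard i, hrρ i]
  have hkρ : k ≤ ∑ i, ρ i := by
    have := Finset.card_nsmul_le_sum (univ : Finset (Fin k)) ρ 1 fun i _ => hρ1 i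
    simpa using this
  have hsumr : ∑ i, r i = (∑ i, (c i - 1)) * κ + ∑ i, ρ i := by
    rw [sum_mul, ← sum_add_distrib]
    exact sum_congr rfl fun i _ => (hrρ i).symm
  calc #(∑ i, tower g K (c i - 1) (X i))
      ≤ #(tower g K (∑ i, (c i - 1)) (∑ i, X i)) :=
        card_le_card (sum_tower_subset g hK0 hKadd k (fun i => c i - 1) X hXK)
    _ ≤ (∑ i, (c i - 1)) * #K + #(∑ i, X i) := card_tower_le _ _ _ _
    _ ≤ (∑ i, (c i - 1)) * κ + (∑ i, ρ i - (k - 1)) := by rw [hKκ]; exact Nat.add_le_add_left hXsum _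
    _ = ∑ i, r i - (k - 1) := by rw [hsumr]; omega

/-- **Small sumsets property for `k` summands**, instance form: `μ_G^{(k)}(r₁,…,r_k) ≤ r₁ + ⋯ + r_k − k + 1` for
`1 ≤ r_i ≤ |G|` in a finite abelian group. [cite: Plagne2007, p. 379 eq. (2)] -/
theorem exists_card_sum_le_sum_sub' [Fintype G] {k : ℕ} (hk : 1 ≤ k) (r : Fin k → ℕ) (hr : ∀ i, 1 ≤ r i)
    (hrG : ∀ i, r i ≤ Fintype.card G) :
    ∃ A : Fin k → Finset G, (∀ i, #(A i) = r i) ∧ #(∑ i, A i) ≤ ∑ i, r i - (k - 1) :=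
  exists_card_sum_le_sum_sub _ G rfl k r hk hr hrG

/-! ### Fibres of a quotient map (private plumbing, as in `OptimallySmallSumsets.lean`) -/

omit [DecidableEq G] in
/-- All fibres of a surjective homomorphism have the same size. [folklore] -/
private theorem card_filter_eq_card_filter_zero [Fintype G] {C : Type*} [AddCommGroup C] [DecidableEq C]
    (ψ : G →+ C) (hψ : Function.Surjective ψ) (c : C) :
    #(univ.filter fun x => ψ x = c) = #(univ.filter fun x => ψ x = 0) := by
  obtain ⟨g, hg⟩ := hψ c
  refine card_bij (fun x _ => x - g) ?_ ?_ ?_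
  · intro x hx
    rw [mem_filter] at hx ⊢
    exact ⟨mem_univ _, by rw [map_sub, hx.2, hg, sub_self]⟩
  · intro x _ y _ h
    exact sub_left_injective h
  · intro y hy
    rw [mem_filter] at hy
    refine ⟨y + g, ?_, by simp⟩
    rw [mem_filter, map_add, hy.2, hg, zero_add]
    exact ⟨mem_univ _, rfl⟩

omit [DecidableEq G] in
/-- The preimage of `S` under a surjective homomorphism has `|S|·|fibre|` elements. [folklore] -/
private theorem card_filter_mem_eq' [Fintype G] {C : Type*} [AddCommGroup C] [DecidableEq C]
    (ψ : G →+ C) (hψ : Function.Surjective ψ) (S : Finset C) :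
    #(univ.filter fun x => ψ x ∈ S) = #S * #(univ.filter fun x => ψ x = 0) := by
  classical
  have hunion : (univ.filter fun x => ψ x ∈ S) = S.biUnion fun c => univ.filter fun x => ψ x = c := by
    ext x; simp
  rw [hunion, card_biUnion, Finset.sum_congr rfl (fun c _ => card_filter_eq_card_filter_zero ψ hψ c),
    sum_const, smul_eq_mul]
  intro c _ d _ hcd
  rw [Function.onFun, disjoint_left]
  intro x hxc hxd
  rw [mem_filter] at hxc hxd
  exact hcd (hxc.2.symm.trans hxd.2)

/-- Preimages of a sum contain the sum of preimages (for subsets of preimages). [folklore] -/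
private theorem sum_subset_filter_sum [Fintype G] {C : Type*} [AddCommGroup C] [DecidableEq C]
    (ψ : G →+ C) : ∀ (k : ℕ) (A : Fin k → Finset G) (A' : Fin k → Finset C),
      (∀ i, A i ⊆ univ.filter fun x => ψ x ∈ A' i) → ∑ i, A i ⊆ univ.filter fun x => ψ x ∈ ∑ i, A' i
  | 0, A, A', _ => by
    intro z hz
    have hz0 : z = 0 := by simpa using hz
    subst hz0
    simp
  | k + 1, A, A', h => by
    rw [Fin.sum_univ_castSucc (f := A), Fin.sum_univ_castSucc (f := A')]
    refine add_subset_iff.2 fun x hx y hy => mem_filter.2 ⟨mem_univ _, ?_⟩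
    have hx' := (mem_filter.1 (sum_subset_filter_sum ψ k _ _ (fun i => h _) hx)).2
    have hy' := (mem_filter.1 (h _ hy)).2
    rw [map_add]
    exact add_mem_add hx' hy'

/-! ### The upper bound for every divisor, and Plagne's formula, in every finite abelian group -/

/-- **Plagne's upper bound (the construction), every finite abelian group.**  For `d ∣ |G|`, `k ≥ 1` and
`1 ≤ r_i ≤ |G|` there are `A_i ⊆ G` with `|A_i| = r_i` and `|Σ A_i| ≤ (Σ⌈r_i/d⌉ − k + 1)·d`: a subgroup `H` of
order `d`, sets of `⌈r_i/d⌉` elements of `G/H` with the small sumsets property (`exists_card_sum_le_sum_sub`),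
and `r_i` elements of their preimages. [cite: Plagne2007, p. 379 eq. (2)] -/
theorem exists_card_sum_le_ekpTermK [Fintype G] {d : ℕ} (hd : d ∣ Fintype.card G) {k : ℕ} (hk : 1 ≤ k)
    (r : Fin k → ℕ) (hr : ∀ i, 1 ≤ r i) (hrG : ∀ i, r i ≤ Fintype.card G) :
    ∃ A : Fin k → Finset G, (∀ i, #(A i) = r i) ∧ #(∑ i, A i) ≤ ekpTermK d r := by
  classical
  -- a subgroup of order `d` and the quotient map
  have hd' : d ∣ Nat.card G := by rwa [Nat.card_eq_fintype_card]
  obtain ⟨H, hH⟩ := Literature.GroupTheory.FiniteAbelian.exists_addSubgroup_card_eq_of_dvd_card G hd'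
  have hdpos : 0 < d := Nat.pos_of_dvd_of_pos hd Fintype.card_pos
  let π : G →+ G ⧸ H := QuotientAddGroup.mk' H
  have hπ : Function.Surjective π := QuotientAddGroup.mk'_surjective H
  haveI : Fintype (G ⧸ H) := Fintype.ofFinite _
  -- fibres of `π` have `d` elements, `|G| = |G/H|·d`
  have hker : Nat.card π.ker = d := by rw [show π.ker = H from QuotientAddGroup.ker_mk' H, hH]
  have hfib : #(univ.filter fun x => π x = 0) = d := by
    rw [← hker,
      Nat.card_congr (Equiv.subtypeEquivRight (fun x => AddMonoidHom.mem_ker) : π.ker ≃ {x : G // π x = 0}),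
      Nat.card_eq_fintype_card, Fintype.card_subtype]
  have hQ : Fintype.card G = Fintype.card (G ⧸ H) * d := by
    have h := card_filter_mem_eq' π hπ (univ : Finset (G ⧸ H))
    rw [hfib, card_univ] at h
    rw [← h]
    simp
  -- the quotient sets
  have hc1 : ∀ i, 1 ≤ (r i + d - 1) / d := fun i => by
    rw [Nat.one_le_div_iff hdpos]; have := hr i; omega
  have hcQ : ∀ i, (r i + d - 1) / d ≤ Fintype.card (G ⧸ H) := fun i => by
    rw [← Nat.lt_add_one_iff, Nat.div_lt_iff_lt_mul hdpos, Nat.succ_mul]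
    have := hrG i; rw [hQ] at this; omega
  obtain ⟨A', hA'0, hA'sum0⟩ :=
    exists_card_sum_le_sum_sub' (G := G ⧸ H) hk (fun i => (r i + d - 1) / d) hc1 hcQ
  have hA' : ∀ i, #(A' i) = (r i + d - 1) / d := hA'0
  have hA'sum : #(∑ i, A' i) ≤ ∑ i, (r i + d - 1) / d - (k - 1) := hA'sum0
  -- preimages
  have hrA : ∀ i, r i ≤ #(univ.filter fun x => π x ∈ A' i) := fun i => by
    rw [card_filter_mem_eq' π hπ (A' i), hfib, hA' i]
    have h := Nat.lt_div_mul_add (a := r i + d - 1) hdpos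
    have : (r i + d - 1) / d * d + d = ((r i + d - 1) / d + 1) * d := by ring
    omega
  have hAi : ∀ i, ∃ A : Finset G, A ⊆ (univ.filter fun x => π x ∈ A' i) ∧ #A = r i := fun i =>
    exists_subset_card_eq (hrA i)
  choose A hAsub hAcard using hAi
  refine ⟨A, hAcard, ?_⟩
  have hk' : k ≤ ∑ i, (r i + d - 1) / d := by
    have := Finset.card_nsmul_le_sum (univ : Finset (Fin k)) (fun i => (r i + d - 1) / d) 1 fun i _ => hc1 i
    simpa using this
  calc #(∑ i, A i) ≤ #(univ.filter fun x => π x ∈ ∑ i, A' i) :=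
        card_le_card (sum_subset_filter_sum π k A A' hAsub)
    _ = #(∑ i, A' i) * d := by rw [card_filter_mem_eq' π hπ, hfib]
    _ ≤ (∑ i, (r i + d - 1) / d - (k - 1)) * d := Nat.mul_le_mul_right _ hA'sum
    _ = ekpTermK d r := by rw [ekpTermK_def, Nat.sub_mul, mul_comm d]

/-- **Plagne's formula in every finite abelian group: `μ_G^{(k)}(r₁,…,r_k) = min_{d ∣ |G|} (Σ⌈r_i/d⌉ − k + 1)·d`.**
For `k ≥ 1` and `1 ≤ r_i ≤ |G|` there are `A_i ⊆ G` with `|A_i| = r_i` and `|A₁ + ⋯ + A_k| = ekpMuK |G| r`;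
with `ekpMuK_le_card_sum` (every family of non-empty sets has `ekpMuK |G| (|A_i|)_i ≤ |Σ A_i|`) this is the
printed equality (2) for finite abelian `G` (print: arbitrary abelian `G`, `D` = orders of finite subgroups).
[cite: Plagne2007, p. 379 eq. (2)] -/
theorem exists_card_sum_eq_ekpMuK [Fintype G] {k : ℕ} (hk : 1 ≤ k) (r : Fin k → ℕ) (hr : ∀ i, 1 ≤ r i)
    (hrG : ∀ i, r i ≤ Fintype.card G) :
    ∃ A : Fin k → Finset G, (∀ i, #(A i) = r i) ∧ #(∑ i, A i) = ekpMuK (Fintype.card G) r := by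
  have hn : Fintype.card G ≠ 0 := Fintype.card_ne_zero
  obtain ⟨d, hd, hdpos, hmu⟩ := exists_dvd_ekpMuK_eq hn r
  obtain ⟨A, hA, hle⟩ := exists_card_sum_le_ekpTermK hd hk r hr hrG
  refine ⟨A, hA, le_antisymm (hmu ▸ hle) ?_⟩
  have hAne : ∀ i, (A i).Nonempty := fun i => card_pos.1 (by rw [hA i]; exact hr i)
  have h := ekpMuK_le_card_sum hk A hAne
  have hfun : (fun i => #(A i)) = r := funext hA
  rwa [hfun] at h

end General

end Literature.Combinatorics.Additive
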